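import Mathlib
import Summits.ValiantsHypothesis.ValiantsHypothesis.Theorems.BarrierLeverPartitionMinorsHitByVPHiddenStatesMultiSwapCells
import Summits.ValiantsHypothesis.ValiantsHypothesis.Theorems.BarrierLeverPartitionMinorsHitByVPHiddenStatesSecondShellTwoTops

/-!
# Route BarrierLever — item `PartitionMinorsHitByVP` (stmt-ValiantsHypothesis-19717), line `hidden-states`:
# ★★ m-TH-SHELL CELLS WITH PRESCRIBED TOPS — immobile tokens AND unfed pairs (THEOREM 2U), every `m, t, h`

Helper file (`--supports stmt-ValiantsHypothesis-19717`; cell valiant-natproofs, 𝒟-side door (c), registered line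
`Cruxes/PartitionMinorsHitByVP/Lines/hidden_states.lean` v8; prover seat val-np-p6 gen 17).  Closes NO item; definition-free.

Generalises `…MultiSwapCells.exists_table_multiSwap_immobile` (immobile tokens only) and `…SecondShellTwoTops` (m = 2): matched swaps
`(A_l, C_l)` in `Fin h` with a chosen TOP `y_l ∈ C_l ∖ A_l` and SECOND element `p_l ∈ (C_l ∖ A_l) ∖ {y_l}` for every path (realised by
`exists_equiv_four_tops`).  With these data a coordinate `z` is GLOBALLY UNFED iff it is no X-element and, whenever it is a Y-element of swap
`k`, it is the top `y_k` (`swapTable'_col_unit`); its sources are the `p_k` with `y_k = z` (`swapTable'_top_row`).  A cross minor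
`D_{B − A_i + C_j}` vanishes for every parameter if EITHER some `z ∈ C_j ∖ A_i` is a Y-element of no swap (immobile token) OR two distinct
globally unfed `z₁, z₂ ∈ C_j ∖ A_i` have disjoint sources (THEOREM 2U, `…TwoUnfed`).  If every permutation `σ ≠ 1` meets such a zero at some
`(l, σ l)`, `…MultiSwapExchange.exists_table_of_unique_matching` serves the class.  ★★ `exists_table_multiSwap_tops` (table-free hypotheses).

HONEST LABEL: conjecture-column cells (m-th shell of every ball); 19717 stays OPEN; nothing on crux 14610 or VP ≠ VNP.
-/

set_option linter.dupNamespace false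

namespace Summit.ValiantsHypothesis.ValiantsHypothesis.Theorems.BarrierLever.HiddenStates

open Finset

noncomputable section

namespace SecondShell

open PathTable

/-- ★★ **m-TH SHELL WITH PRESCRIBED TOPS.**  Swaps `(A_l, C_l)` (`|A_l| = t`, `|C_l| = t+1`, `A_l ⊄ C_l`, `A`, `C` injective), tops `y_l` and
second elements `p_l` of the paths; `GU z` := `z` is no X-element and is the top of every path it lies on.  If every permutation `σ ≠ 1`
has an `l` with, for the pair `(A_l, C_{σ l})`, an immobile token or two distinct globally unfed tokens of `C_{σ l} ∖ A_l` whose source sets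
`{p_k : y_k = z}` are disjoint, then every injective row family in `B_t(h) ∖ {A_l} ∪ {C_l}` with columns covering `B_t(h)` is served. -/
theorem exists_table_multiSwap_tops (h t : ℕ) {m : ℕ} (hm : 0 < m) (A C : Fin m → Finset (Fin h))
    (hA : ∀ l, (A l).card = t) (hC : ∀ l, (C l).card = t + 1) (hAC : ∀ l, ¬ A l ⊆ C l)
    (hAinj : Function.Injective A) (hCinj : Function.Injective C)
    (y p : Fin m → Fin h) (hy : ∀ l, y l ∈ C l ∧ y l ∉ A l) (hp : ∀ l, p l ∈ C l ∧ p l ∉ A l ∧ p l ≠ y l)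
    (hZ : ∀ σ : Equiv.Perm (Fin m), σ ≠ 1 → ∃ l,
      (∃ z, z ∈ C (σ l) ∧ z ∉ A l ∧ ∀ k, z ∈ C k → z ∈ A k) ∨
      (∃ z₁ z₂, z₁ ≠ z₂ ∧ z₁ ∈ C (σ l) ∧ z₁ ∉ A l ∧ z₂ ∈ C (σ l) ∧ z₂ ∉ A l ∧
        (∀ k, ¬ (z₁ ∈ A k ∧ z₁ ∉ C k) ∧ (z₁ ∈ C k → z₁ ∉ A k → z₁ = y k)) ∧
        (∀ k, ¬ (z₂ ∈ A k ∧ z₂ ∉ C k) ∧ (z₂ ∈ C k → z₂ ∉ A k → z₂ = y k)) ∧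
        (∀ k k', y k = z₁ → y k' = z₂ → p k ≠ p k')))
    {r : ℕ} (u cols : Fin r → Finset (Fin h)) (hu : Function.Injective u)
    (hU : ∀ i, ((u i).card ≤ t ∧ ∀ l, u i ≠ A l) ∨ ∃ l, u i = C l)
    (hcols : ∀ J : Finset (Fin h), J.card ≤ t → ∃ kk, cols kk = J) :
    ∃ tx : Option (Fin h) → Fin h → ℂ,
      (Matrix.of fun i kk : Fin r => ∏ a ∈ u i, (tx none a + ∑ q ∈ cols kk, tx (some q) a)).det ≠ 0 := by
  classical
  -- transports with prescribed tops, and tables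
  have hsz := fun l => swap_sizes (A l) (C l) (hA l) (hC l) (hAC l)
  choose k j j' hk hkj a1 a2 a3 a4 using hsz
  have he := fun l => exists_equiv_four_tops (A l) (C l) (hk l) (a1 l) (a2 l) (a3 l) (a4 l)
    (Finset.mem_sdiff.2 ⟨(hy l).1, (hy l).2⟩) (Finset.mem_sdiff.2 ⟨(hp l).1, (hp l).2.1⟩) (Ne.symm (hp l).2.2)
  choose e m1 m2 m3 m4 htop hpred using he
  let N : Fin m → Fin h → Fin h → ℂ := fun l a q => swapTable' (e l) a q - if q = a then 1 else 0
  have hTl : ∀ l, tabM N (Pi.single l 1) = swapTable' (e l) := by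
    intro l; funext a q
    simp only [tabM, N]
    rw [Finset.sum_eq_single l]
    · simp
    · intro l' _ hl'; simp [hl']
    · intro hl; exact (hl (Finset.mem_univ l)).elim
  -- bookkeeping (as in `exists_table_multiSwap_immobile`)
  set Ball := Finset.univ.filter fun S : Finset (Fin h) => S.card ≤ t with hBall
  set 𝒰 := (Ball \ Finset.univ.image A) ∪ Finset.univ.image C with h𝒰
  have hAB : ∀ l, A l ∈ Ball := fun l => Finset.mem_filter.2 ⟨Finset.mem_univ _, by rw [hA l]⟩
  have hCB : ∀ l, C l ∉ Ball := fun l hl => by have := (Finset.mem_filter.1 hl).2; rw [hC l] at this; omega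
  have h𝒰card : 𝒰.card = Ball.card := by
    rw [h𝒰, Finset.card_union_of_disjoint]
    · rw [Finset.card_sdiff_of_subset (fun x hx => by obtain ⟨l, -, rfl⟩ := Finset.mem_image.1 hx; exact hAB l),
        Finset.card_image_of_injective _ hAinj, Finset.card_image_of_injective _ hCinj, Finset.card_univ, Fintype.card_fin]
      have : m ≤ Ball.card := by
        calc m = (Finset.univ.image A).card := by
              rw [Finset.card_image_of_injective _ hAinj, Finset.card_univ, Fintype.card_fin]
          _ ≤ Ball.card := Finset.card_le_card fun x hx => by
              obtain ⟨l, -, rfl⟩ := Finset.mem_image.1 hx; exact hAB l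
      omega
    · rw [Finset.disjoint_left]
      intro x hx hx'
      obtain ⟨l, -, rfl⟩ := Finset.mem_image.1 hx'
      exact hCB l (Finset.mem_sdiff.1 hx).1
  have hUmem : ∀ i, u i ∈ 𝒰 := by
    intro i
    rcases hU i with ⟨hc, hne⟩ | ⟨l, hl⟩
    · refine Finset.mem_union_left _ (Finset.mem_sdiff.2 ⟨Finset.mem_filter.2 ⟨Finset.mem_univ _, hc⟩, fun hx => ?_⟩)
      obtain ⟨l, -, hl⟩ := Finset.mem_image.1 hx
      exact hne l hl.symm
    · exact Finset.mem_union_right _ (Finset.mem_image.2 ⟨l, Finset.mem_univ _, hl.symm⟩)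
  obtain ⟨hhit, hcolcard⟩ := rows_cover t 𝒰 h𝒰card u cols hu hUmem hcols
  have hidx' := fun l => hhit (C l) (Finset.mem_union_right _ (Finset.mem_image.2 ⟨l, Finset.mem_univ _, rfl⟩))
  choose idx hidx using hidx'
  have hidxinj : Function.Injective idx := fun l l' hll' => hCinj (by rw [← hidx l, ← hidx l', hll'])
  have hslot : ∀ i l, u i = C l → i = idx l := fun i l hil => hu (by rw [hil, hidx l])
  let b : Fin r → Finset (Fin h) := replaced u idx A
  have hbslot : ∀ l, b (idx l) = A l := fun l => replaced_idx u hidxinj A l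
  have hboff : ∀ i, (∀ l, idx l ≠ i) → b i = u i := fun i hi => replaced_other u idx A hi
  have hboff' : ∀ i, (∀ l, idx l ≠ i) → (u i).card ≤ t ∧ ∀ l, u i ≠ A l := by
    intro i hi
    rcases hU i with h' | ⟨l, hl⟩
    · exact h'
    · exact absurd (hslot i l hl) (Ne.symm (hi l))
  have hub : replaced b idx C = u := by
    funext i
    by_cases hi : ∃ l, idx l = i
    · obtain ⟨l, rfl⟩ := hi; rw [replaced_idx b hidxinj C l, hidx l]
    · have hi' : ∀ l, idx l ≠ i := fun l hl => hi ⟨l, hl⟩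
      rw [replaced_other b idx C hi', hboff i hi']
  have hbinj : Function.Injective b := by
    intro i i' hii'
    by_cases hi : ∃ l, idx l = i
    · obtain ⟨l, rfl⟩ := hi
      by_cases hi' : ∃ l', idx l' = i'
      · obtain ⟨l', rfl⟩ := hi'
        rw [hbslot, hbslot] at hii'; rw [hAinj hii']
      · have hi'' : ∀ l', idx l' ≠ i' := fun l' hl => hi' ⟨l', hl⟩
        rw [hbslot, hboff i' hi''] at hii'
        exact absurd hii'.symm ((hboff' i' hi'').2 l)
    · have hi1 : ∀ l, idx l ≠ i := fun l hl => hi ⟨l, hl⟩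
      by_cases hi' : ∃ l', idx l' = i'
      · obtain ⟨l', rfl⟩ := hi'
        rw [hboff i hi1, hbslot] at hii'
        exact absurd hii' ((hboff' i hi1).2 l')
      · have hi'' : ∀ l', idx l' ≠ i' := fun l' hl => hi' ⟨l', hl⟩
        rw [hboff i hi1, hboff i' hi''] at hii'
        exact hu hii'
  have hbcard : ∀ i, (b i).card ≤ t := by
    intro i
    by_cases hi : ∃ l, idx l = i
    · obtain ⟨l, rfl⟩ := hi; rw [hbslot, hA l]
    · have hi1 : ∀ l, idx l ≠ i := fun l hl => hi ⟨l, hl⟩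
      rw [hboff i hi1]; exact (hboff' i hi1).1
  have hbC : ∀ i l, b i ≠ C l := by
    intro i l hil
    have := hbcard i; rw [hil, hC l] at this; omega
  -- the m first-shell certificates
  have hdiag : ∀ l, (mat (tabM N (Pi.single l 1)) (Function.update b (idx l) (C l)) cols).det ≠ 0 := by
    intro l
    rw [hTl l]
    refine swapTable'_det_ne_zero (hk l) (A l) (C l) (e l) (m1 l) (m2 l) (m3 l) (m4 l) _ cols
      (update_injective b hbinj (idx l) (C l) (fun i => hbC i l)) ?_ (by rw [hkj l]; exact hcols)
    intro i
    by_cases hi : i = idx l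
    · right; rw [hi, Function.update_self]
    · left
      rw [Function.update_of_ne hi, hkj l]
      refine ⟨hbcard i, ?_⟩
      by_cases hi' : ∃ l', idx l' = i
      · obtain ⟨l', rfl⟩ := hi'
        rw [hbslot]; exact fun hh => hi (by rw [hAinj hh])
      · have hi1 : ∀ l', idx l' ≠ i := fun l' hl => hi' ⟨l', hl⟩
        rw [hboff i hi1]; exact (hboff' i hi1).2 l
  -- table facts for globally unfed coordinates
  have hdiagT : ∀ ε a, tabM N ε a a = 1 := by intro ε a; simp [tabM, N, swapTable'_self]
  have hcolGU : ∀ ε z, (∀ k', ¬ (z ∈ A k' ∧ z ∉ C k') ∧ (z ∈ C k' → z ∉ A k' → z = y k')) →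
      ∀ a, a ≠ z → tabM N ε a z = 0 := by
    intro ε z hGU a ha
    have hk0 : ∀ k', swapTable' (e k') a z = 0 := by
      intro k'
      refine swapTable'_col_unit (A k') (C k') (e k') (m1 k') (m2 k') (fun h' => (hGU k').1 (Finset.mem_sdiff.1 h')) ?_ ha
      intro h'
      rw [htop k']
      exact (hGU k').2 (Finset.mem_sdiff.1 h').1 (Finset.mem_sdiff.1 h').2
    simp [tabM, N, hk0, if_neg (Ne.symm ha)]
  have hrowGU : ∀ ε z, (∀ k', ¬ (z ∈ A k' ∧ z ∉ C k') ∧ (z ∈ C k' → z ∉ A k' → z = y k')) →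
      ∀ d, d ≠ z → (∀ k', y k' = z → d ≠ p k') → tabM N ε z d = 0 := by
    intro ε z hGU d hdz hnot
    have hk0 : ∀ k', swapTable' (e k') z d = 0 := by
      intro k'
      by_contra h'
      have hzY : z ∈ C k' \ A k' := swapTable'_offdiag (A k') (C k') (e k') (m1 k') h' hdz
      have hzt : z = y k' := (hGU k').2 (Finset.mem_sdiff.1 hzY).1 (Finset.mem_sdiff.1 hzY).2
      rw [hzt, ← htop k'] at h'
      have hd := swapTable'_top_row (hk k') (e k') h' (by rw [htop k', ← hzt]; exact hdz)
      rw [hpred k'] at hd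
      exact hnot k' hzt.symm hd
    simp [tabM, N, hk0, if_neg hdz]
  -- rows of the one-row-replaced families, and the ball hypothesis of the vanishing lemmas
  have hAll : ∀ (l : Fin m) (S : Finset (Fin h)) (R : Finset (Fin h)), R.card ≤ t → R ≠ A l →
      ∃ i, i ≠ idx l ∧ Function.update b (idx l) S i = R := by
    intro l S R hR hRA
    by_cases hRA' : ∃ l', R = A l'
    · obtain ⟨l', rfl⟩ := hRA'
      have hll' : l' ≠ l := fun hh => hRA (by rw [hh])
      refine ⟨idx l', fun hh => hll' (hidxinj hh), ?_⟩
      rw [Function.update_of_ne (fun hh => hll' (hidxinj hh)), hbslot]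
    · have hR𝒰 : R ∈ 𝒰 := by
        refine Finset.mem_union_left _ (Finset.mem_sdiff.2 ⟨Finset.mem_filter.2 ⟨Finset.mem_univ _, hR⟩, fun hx => ?_⟩)
        obtain ⟨l', -, hl'⟩ := Finset.mem_image.1 hx
        exact hRA' ⟨l', hl'.symm⟩
      obtain ⟨i, hi⟩ := hhit R hR𝒰
      have hioff : ∀ l', idx l' ≠ i := by
        intro l' hh
        have : u i = C l' := by rw [← hh, hidx l']
        rw [hi] at this; rw [this, hC l'] at hR; omega
      refine ⟨i, (hioff l).symm, ?_⟩
      rw [Function.update_of_ne (hioff l).symm, hboff i hioff, hi]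
  -- the vanishing cross minors
  have hzero : ∀ σ : Equiv.Perm (Fin m), σ ≠ 1 →
      ∃ l, ∀ ε, (mat (tabM N ε) (Function.update b (idx l) (C (σ l))) cols).det = 0 := by
    intro σ hσ
    obtain ⟨l, hl⟩ := hZ σ hσ
    refine ⟨l, fun ε => ?_⟩
    rcases hl with ⟨z, hzC, hzAl, hzk⟩ | ⟨z₁, z₂, hne, h₁C, h₁A, h₂C, h₂A, hGU₁, hGU₂, hpp⟩
    · -- immobile token
      have hrowk : ∀ k' q, q ≠ z → swapTable' (e k') z q = 0 := by
        intro k' q hq; by_contra h'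
        have := swapTable'_offdiag (A k') (C k') (e k') (m1 k') h' hq
        rw [Finset.mem_sdiff] at this; exact this.2 (hzk k' this.1)
      refine det_eq_zero_of_trapped (tabM N ε) {z} ?_ t (Function.update b (idx l) (C (σ l))) cols hcolcard (idx l) ?_ ?_
      · intro a ha q hq
        rw [Finset.mem_singleton] at ha; subst ha
        rw [Finset.mem_singleton]
        by_contra hqa
        apply hq
        simp [tabM, N, hrowk _ q hqa, if_neg hqa]
      · rw [Function.update_self]
        exact ⟨z, Finset.mem_inter.2 ⟨hzC, Finset.mem_singleton_self z⟩⟩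
      · intro R hR hRz
        obtain ⟨x, hx⟩ := hRz
        rw [Finset.mem_inter, Finset.mem_singleton] at hx
        obtain ⟨hxR, rfl⟩ := hx
        exact hAll l (C (σ l)) R hR (fun hh => hzAl (hh ▸ hxR))
    · -- two globally unfed tokens with disjoint sources: THEOREM 2U
      have hdisj : ∀ d, d ≠ z₁ → d ≠ z₂ → tabM N ε z₁ d * tabM N ε z₂ d = 0 := by
        intro d hd1 hd2
        by_cases h1 : ∃ k', y k' = z₁ ∧ d = p k'
        · obtain ⟨k₁, hk₁y, hk₁p⟩ := h1
          have : tabM N ε z₂ d = 0 := hrowGU ε z₂ hGU₂ d hd2 (fun k' hk' hd => hpp k₁ k' hk₁y hk' (hk₁p.symm.trans hd))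
          rw [this, mul_zero]
        · push Not at h1
          have : tabM N ε z₁ d = 0 := hrowGU ε z₁ hGU₁ d hd1 (fun k' hk' hd => h1 k' hk' hd)
          rw [this, zero_mul]
      refine det_eq_zero_of_two_unfed (tabM N ε) hne (hcolGU ε z₁ hGU₁) (hcolGU ε z₂ hGU₂) (hdiagT ε z₁) (hdiagT ε z₂) hdisj t
        (Function.update b (idx l) (C (σ l))) cols hcolcard (idx l) (by rw [Function.update_self, hC])
        (by rw [Function.update_self]; exact h₁C) (by rw [Function.update_self]; exact h₂C) (A l) (hA l) h₁A h₂A ?_ ?_ ?_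
      · intro i
        by_cases hi : i = idx l
        · rw [hi, Function.update_self]; intro h'; have := hA l; rw [← h', hC] at this; omega
        · rw [Function.update_of_ne hi]
          by_cases hi' : ∃ l', idx l' = i
          · obtain ⟨l', rfl⟩ := hi'
            rw [hbslot]; exact fun hh => hi (by rw [hAinj hh])
          · have hi1 : ∀ l', idx l' ≠ i := fun l' hl' => hi' ⟨l', hl'⟩
            rw [hboff i hi1]; exact (hboff' i hi1).2 l
      · intro i hi
        rw [Function.update_of_ne hi]; exact hbcard i
      · intro R hR hRA
        exact hAll l (C (σ l)) R hR hRA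
  obtain ⟨tx, htx⟩ := exists_table_of_unique_matching hm N t b cols hbinj hbcard hcols hidxinj C hdiag hzero
  exact ⟨tx, by rw [hub] at htx; exact htx⟩

end SecondShell

end

end Summit.ValiantsHypothesis.ValiantsHypothesis.Theorems.BarrierLever.HiddenStates
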